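import Literature.InformationTheory.QuantumCodes.QuantumExpanderNoisySyndromeLemma26
import HarnessLib

/-!
# Small-set-flip with a NOISY syndrome (Fawzi–Grospellier–Leverrier, FOCS 2018), part 9: the residual of one noisy round has reduced
# weight `≤ c₀·|D|` outside the `α`-percolation event — and that event is exponentially unlikely under local stochastic noise — PROOF

Index of sources: `[cite: FawziGrospellierLeverrier2018FT]` = Fawzi–Grospellier–Leverrier, FOCS 2018 / arXiv:1808.03821: Thm. 13 (p0016 L66-73; one noisy
round, local stochastic `(E, D)`: "there exists an event succ that has probability `1 − …` and a random variable `E_ls` that is equivalent to `E ⊕ Ê`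
such that conditioned on succ, `E_ls` has a local stochastic distribution"), Lemma 26, Lemma 27 (`α`-percolation on `𝒢`), proof of Thm. 13 (p0021
L23-26: succ `:= MaxConn_{α₀}(E ∪ D) ≤ γ₀√n`); `[cite: FawziGrospellierLeverrier2018]` Thm. 17 (the `α`-percolation bound; tree
`sum_hasAlphaCluster_le_geometric`, Peierls constant).

Topic `Literature/InformationTheory/QuantumCodes` (venture QEC, row 04 `prover-qec-type-04` gen 8, line L-SSF-NOISY = PARTITION v2.48 D50.L8, node N18).
WHAT IS PROVED HERE — a WEAKER BUT COMPLETE form of Thm. 13's conclusion (OURS as a statement; the printed Thm. 13 asserts local stochasticity of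
`E_ls` on succ, which needs the witness union bound over `𝓜(S)` not yet in the tree): on the event succ the residual `E ⊕ Ê` of ANY small-set-flip
decoder of the tree is equivalent modulo `C_Z^⊥` to a word of weight `≤ c₀·|D|` (`c₀ = 4/(min Δ·β₁ − 2κ)`) — from Lemma 26 with the witness
`W = supp E_ls` — and, for a locally stochastic law `μ` of the joint error `X = E ⊔ D ⊆ V ⊔ C_X` (parameter `p`; the tree's one-parameter vocabulary,
FGL18b Def. 9 with `p = max(p_phys, p_synd)`) and any syndrome adjacency graph `𝒢` on `V ⊔ C_X` with degrees `≤ Δ'` (e.g. `syndromeAdjGraph`,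
`SyndromeAdjacencyGraph.lean`), the failure event has `μ`-weight `≤ |V ⊔ C_X|·r^{t+1}/(Δ'²(1 − r))`, `r = 2Δ'² p^{α₀}`, `α₀ = κ/(2(κ + max Δ))`, for every
`t` with `max Δ·t ≤ min Δ·min(γ_A n_A, γ_B n_B)` — exponentially small in `t = Θ(min(γ_A n_A, γ_B n_B))`, i.e. in `√n`.

* `fgl18b_residual_le_of_not_hasAlphaCluster` — deterministic: outside `HasAlphaCluster 𝒢 α₀ (t+1) (E ⊔ D)`, residual `≡` a word of weight `≤ c₀|D|`;
* ★ `fgl18b_singleShot_stochastic` — the `μ`-weight of the joint errors whose residual is NOT within `c₀|D|` of `C_Z^⊥` is at most the `α`-percolation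
  bound.

Column word: PROVED (kernel); no definitions, no named facts. (Thm. 13 as printed — `E_ls` locally stochastic with parameter `K p_synd^{1/c₀}` — is NOT
claimed.)
-/

namespace Literature.InformationTheory.QuantumCodes

open Finset Matrix Literature.Probability.LatticeModels

namespace QuantumExpander

variable {A B : Type*} [Fintype A] [Fintype B] [DecidableEq A] [DecidableEq B]

/-- **Outside the percolation event the residual is within `c₀|D|` of the stabilizers** (deterministic; Lemma 26 with the witness
`W = supp E_ls`): hypotheses as in `fgl18b_lemma26`; conclusion: the residual `E ⊕ Ê` of the round is equivalent modulo `C_Z^⊥` to a word of weight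
`≤ c₀·|D|`, `c₀ = 4/(min Δ·β₁ − 2κ)`. [cite: FawziGrospellierLeverrier2018FT, Lemma 26 (arXiv p0020 L41-44) with W = E_ls; Cor 16] -/
theorem fgl18b_residual_le_of_not_hasAlphaCluster (H : Matrix B A (ZMod 2)) {dA dB : ℕ} {γA δA γB δB : ℝ}
    (hreg : IsBiregular H dA dB) (hexp : IsLeftRightExpanding H dA dB γA δA γB δB)
    (hdA : 0 < dA) (hdB : 0 < dB) (hδA : 0 ≤ δA) (hδB : 0 ≤ δB)
    {κ : ℝ} (hκ0 : 0 < κ) (hκ1 : 2 * κ < ((min dA dB : ℕ) : ℝ) * (1 - 16 * max δA δB))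
    (G' : SimpleGraph (((A × A) ⊕ (B × B)) ⊕ (A × B)))
    (hlift : ∀ q q', (checkGraph (Matrix.fromRows (expanderHX H) (expanderHZ H))).Adj q q' →
      G'.Adj (Sum.inl q) (Sum.inl q'))
    (hinc : ∀ c q, expanderHX H c q ≠ 0 → G'.Adj (Sum.inl q) (Sum.inr c))
    (Dec : Decoder (A × B → ZMod 2) ((A × A) ⊕ (B × B) → ZMod 2))
    (hDec : IsSSFDecoder κ (expanderHX H) (expanderHZ H) Dec)
    (E : Finset ((A × A) ⊕ (B × B))) (D : Finset (A × B))
    {t : ℕ} (ht : ((max dA dB : ℕ) : ℝ) * t ≤ ((min dA dB : ℕ) : ℝ) * min (γA * Fintype.card A) (γB * Fintype.card B))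
    (hno : ¬ HasAlphaCluster G' (κ / (2 * (κ + ((max dA dB : ℕ) : ℝ)))) (t + 1) (E.disjSum D)) :
    ∃ e' : (A × A) ⊕ (B × B) → ZMod 2,
      e' + (flipVec E + Dec (expanderHX H *ᵥ flipVec E + flipVec D)) ∈ rowSpace (expanderHZ H) ∧
      (hammingNorm e' : ℝ) ≤ 4 / (((min dA dB : ℕ) : ℝ) * (1 - 16 * max δA δB) - 2 * κ) * D.card := by
  classical
  obtain ⟨eLs, -, -, hequiv, hwit⟩ :=
    fgl18b_lemma26 H hreg hexp hdA hdB hδA hδB hκ0 hκ1 G' hlift hinc Dec hDec E D ht hno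
  refine ⟨eLs, hequiv, ?_⟩
  have h := hwit (supp eLs) subset_rfl (fun _ _ q' hq' _ _ _ => hq')
  have hsupp : ((supp eLs).card : ℝ) = hammingNorm eLs := by simp [supp, hammingNorm]
  rw [hsupp] at h
  have hc0 : 0 ≤ 4 / (((min dA dB : ℕ) : ℝ) * (1 - 16 * max δA δB) - 2 * κ) := by
    apply div_nonneg (by norm_num); linarith
  refine h.trans (mul_le_mul_of_nonneg_left ?_ hc0)
  exact_mod_cast Finset.card_le_card Finset.inter_subset_left

omit [DecidableEq A] [DecidableEq B] in
/-- A joint error `X ⊆ V ⊔ C_X` is the disjoint sum of its qubit part and its check part. [folklore] -/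
private theorem disjSum_parts_eq {Q C : Type*} [Fintype Q] [Fintype C] [DecidableEq Q] [DecidableEq C] (X : Finset (Q ⊕ C)) :
    (univ.filter fun q : Q => Sum.inl q ∈ X).disjSum (univ.filter fun c : C => Sum.inr c ∈ X) = X := by
  ext x
  rw [Finset.mem_disjSum]
  constructor
  · rintro (⟨q, hq, rfl⟩ | ⟨c, hc, rfl⟩)
    · exact (Finset.mem_filter.1 hq).2
    · exact (Finset.mem_filter.1 hc).2
  · intro hx
    cases x with
    | inl q => exact Or.inl ⟨q, Finset.mem_filter.2 ⟨Finset.mem_univ _, hx⟩, rfl⟩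
    | inr c => exact Or.inr ⟨c, Finset.mem_filter.2 ⟨Finset.mem_univ _, hx⟩, rfl⟩

open scoped Classical in
/-- ★ **Stochastic single-shot bound for one noisy round** (a complete, weaker form of FGL18b Thm. 13's conclusion; OURS as a statement). Setting:
`Q_G` for a `(Δ_A, Δ_B)`-biregular `(γ_A, δ_A, γ_B, δ_B)`-expanding `G`, `δ = max(δ_A, δ_B) < 1/16`, `β₁ = 1 − 16δ`; ANY small-set-flip decoder `Dec` of
the tree (`0 < κ`, `2κ < min Δ·β₁`); a syndrome adjacency graph `𝒢` on `V ⊔ C_X` (qubit adjacency + `H_X` incidences) with all degrees `≤ Δ' ≥ 1`; a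
locally stochastic law `μ` of parameter `p ∈ [0,1]` for the joint error `X = E ⊔ D` (qubit part `E`, syndrome part `D`); `α₀ = κ/(2(κ + max Δ))`,
`r = 2Δ'²p^{α₀} < 1`, and `t` with `max Δ·t ≤ min Δ·min(γ_A n_A, γ_B n_B)`. CLAIM: the total `μ`-weight of the joint errors `X` for which the residual
`E ⊕ Dec(σ_X(E) ⊕ 𝟙_D)` is NOT equivalent modulo `C_Z^⊥` to a word of weight `≤ c₀·|D|` (`c₀ = 4/(min Δ·β₁ − 2κ)`) is at most
`|V ⊔ C_X|·r^{t+1}/(Δ'²(1 − r))` — the failure event is contained in the `α₀`-percolation event `MaxConn_{α₀}(E ∪ D) ≥ t + 1` (Lemma 26 / the previous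
theorem), whose weight is the tree's `α`-percolation bound (FGL18b Lemma 27 = FGL18a Thm. 17, Peierls constant).
[cite: FawziGrospellierLeverrier2018FT, Thm 13 (arXiv p0016 L66-73), Lemma 27 (p0021 L12-20), proof of Thm 13 (p0021 L23-26)]
[cite: FawziGrospellierLeverrier2018, Thm 17 (α-percolation)] -/
theorem fgl18b_singleShot_stochastic (H : Matrix B A (ZMod 2)) {dA dB : ℕ} {γA δA γB δB : ℝ}
    (hreg : IsBiregular H dA dB) (hexp : IsLeftRightExpanding H dA dB γA δA γB δB)
    (hdA : 0 < dA) (hdB : 0 < dB) (hδA : 0 ≤ δA) (hδB : 0 ≤ δB)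
    {κ : ℝ} (hκ0 : 0 < κ) (hκ1 : 2 * κ < ((min dA dB : ℕ) : ℝ) * (1 - 16 * max δA δB))
    (G' : SimpleGraph (((A × A) ⊕ (B × B)) ⊕ (A × B))) [DecidableRel G'.Adj]
    (hlift : ∀ q q', (checkGraph (Matrix.fromRows (expanderHX H) (expanderHZ H))).Adj q q' →
      G'.Adj (Sum.inl q) (Sum.inl q'))
    (hinc : ∀ c q, expanderHX H c q ≠ 0 → G'.Adj (Sum.inl q) (Sum.inr c))
    {Δ' : ℕ} (hΔ' : ∀ x, G'.degree x ≤ Δ') (hΔ'1 : 1 ≤ Δ')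
    (Dec : Decoder (A × B → ZMod 2) ((A × A) ⊕ (B × B) → ZMod 2))
    (hDec : IsSSFDecoder κ (expanderHX H) (expanderHZ H) Dec)
    {μ : Finset (((A × A) ⊕ (B × B)) ⊕ (A × B)) → ℝ} {p : ℝ} (hμ : IsLocallyStochastic μ p) (hp0 : 0 ≤ p) (hp1 : p ≤ 1)
    {t : ℕ} (ht : ((max dA dB : ℕ) : ℝ) * t ≤ ((min dA dB : ℕ) : ℝ) * min (γA * Fintype.card A) (γB * Fintype.card B))
    (hr : 2 * (Δ' : ℝ) ^ 2 * p ^ (κ / (2 * (κ + ((max dA dB : ℕ) : ℝ)))) < 1) :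
    ∑ X ∈ univ.filter (fun X : Finset (((A × A) ⊕ (B × B)) ⊕ (A × B)) =>
        ¬ ∃ e' : (A × A) ⊕ (B × B) → ZMod 2,
          e' + (flipVec (univ.filter fun q => Sum.inl q ∈ X)
            + Dec (expanderHX H *ᵥ flipVec (univ.filter fun q => Sum.inl q ∈ X)
                + flipVec (univ.filter fun c => Sum.inr c ∈ X))) ∈ rowSpace (expanderHZ H) ∧
          (hammingNorm e' : ℝ) ≤ 4 / (((min dA dB : ℕ) : ℝ) * (1 - 16 * max δA δB) - 2 * κ)
            * ((univ.filter fun c : A × B => Sum.inr c ∈ X).card : ℝ)), μ X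
      ≤ (Fintype.card (((A × A) ⊕ (B × B)) ⊕ (A × B)) : ℝ)
          * (2 * (Δ' : ℝ) ^ 2 * p ^ (κ / (2 * (κ + ((max dA dB : ℕ) : ℝ))))) ^ (t + 1)
        / ((Δ' : ℝ) ^ 2 * (1 - 2 * (Δ' : ℝ) ^ 2 * p ^ (κ / (2 * (κ + ((max dA dB : ℕ) : ℝ)))))) := by
  classical
  set α : ℝ := κ / (2 * (κ + ((max dA dB : ℕ) : ℝ))) with hαdef
  have hα0 : 0 < α := by rw [hαdef]; positivity
  -- the failure event lies inside the percolation event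
  have hcover : univ.filter (fun X : Finset (((A × A) ⊕ (B × B)) ⊕ (A × B)) =>
        ¬ ∃ e' : (A × A) ⊕ (B × B) → ZMod 2,
          e' + (flipVec (univ.filter fun q => Sum.inl q ∈ X)
            + Dec (expanderHX H *ᵥ flipVec (univ.filter fun q => Sum.inl q ∈ X)
                + flipVec (univ.filter fun c => Sum.inr c ∈ X))) ∈ rowSpace (expanderHZ H) ∧
          (hammingNorm e' : ℝ) ≤ 4 / (((min dA dB : ℕ) : ℝ) * (1 - 16 * max δA δB) - 2 * κ)
            * ((univ.filter fun c : A × B => Sum.inr c ∈ X).card : ℝ))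
      ⊆ univ.filter (fun X => HasAlphaCluster G' α (t + 1) X) := by
    intro X hX
    rw [Finset.mem_filter] at hX ⊢
    refine ⟨Finset.mem_univ _, ?_⟩
    by_contra hno
    apply hX.2
    have hno' : ¬ HasAlphaCluster G' α (t + 1)
        ((univ.filter fun q : (A × A) ⊕ (B × B) => Sum.inl q ∈ X).disjSum
          (univ.filter fun c : A × B => Sum.inr c ∈ X)) := by
      rw [disjSum_parts_eq X]; exact hno
    exact fgl18b_residual_le_of_not_hasAlphaCluster H hreg hexp hdA hdB hδA hδB hκ0 hκ1 G' hlift hinc Dec hDec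
      _ _ ht hno'
  refine (Finset.sum_le_sum_of_subset_of_nonneg hcover fun X _ _ => hμ.nonneg X).trans ?_
  exact sum_hasAlphaCluster_le_geometric hΔ' hΔ'1 hμ hp0 hp1 hα0 (Nat.succ_le_succ (Nat.zero_le t)) hr

end QuantumExpander

end Literature.InformationTheory.QuantumCodes
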